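import Literature.AlgebraicGeometry.Motives.AbelianVarietyImageCommSubalgebraAction
import Literature.AlgebraicGeometry.ComplexMultiplication.TateModuleOfCMFreeRankOne
import Mathlib.LinearAlgebra.Dual.Defs
import HarnessLib

/-!
# A corner subring of `End⁰(X)` dominating a quasi-idempotent `u₀` acts UNITALLY on `Im u₀`, compatibly with `V_ℓ(X ↠ Im u₀)`

D. Mumford, *Abelian Varieties* (1970), §19 (Thm. 1 p. 173: images of endomorphisms are abelian subvarieties, and — proof of
Cor. 2, p. 174 — endomorphisms commuting with an idempotent restrict to its image; Thm. 3 p. 176: `End⁰ = ℚ ⊗ End`,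
`T_ℓ` is faithful).  [Liu2021] App. D, proof of Thm. D.6 (1) (p. 140): «Using Hecke operators, we may find a surjective
homomorphism `ϕ : A_K → B` … such that `ϕ^* : H¹_B(B, ℚ) → H¹_B(A_K, ℚ)[π^∞]` is an isomorphism» — `B = Im u₀` for the block
projector `u₀`, and the block FIELD `R₀ = Z(H)·ε` of the Hecke image (a NON-unital commutative subring of `End⁰(A_K)` with unit
the block idempotent `ε`, ★ `RingTheory/Idempotents/PositiveInvolutionCentreBlockField`) must act on `B` through a UNITAL
`j : R₀ →+* End⁰(B)` («`B` has CM by the Hecke field»).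

For an abelian variety `X` over any field, a commutative ring `R₀` with a NON-UNITAL multiplicative map
`φ : R₀ →ₙ+* End⁰(X)`, and an honest quasi-idempotent `u₀ : X ⟶ X`, `u₀ ≫ u₀ = d • u₀` (`d ≠ 0`) such that `1 ⊗ u₀` commutes with
every `φ r` and is DOMINATED by the corner unit, `φ(1) · (1 ⊗ u₀) = 1 ⊗ u₀` (e.g. `1 ⊗ u₀ = a₀ ε` with `ε = φ 1`, or `1 ⊗ u₀ = d e` with
`ε e = e`):

* `exists_ringHom_endAlgebra_image_of_corner` — a ring homomorphism `j : R₀ →+* End⁰(Im u₀)` (UNITAL: `j 1 = 1` because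
  `(φ 1 - 1)(1 ⊗ u₀) = 0` acts as `0` on `Im u₀`) which on honest elements is restriction, `j r = 1 ⊗ F|_{Im u₀}` whenever
  `φ r = 1 ⊗ F`, and whose `ℓ`-adic action is INTERTWINED by `V_ℓ(X ↠ Im u₀)`:
  `V_ℓ(j r) ∘ V_ℓ(ū₀) = V_ℓ(ū₀) ∘ V_ℓ(φ r)` for every prime `ℓ` (by ★ `AbelianVarietyImageCommSubalgebraAction` applied to the
  commutative subalgebra `ℚ[φ(R₀), 1 ⊗ u₀]`, ★ `endAlgebra.exists_eq_algebraMap_mul_of`, ★ `toImage_imageRestrict`,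
  ★ `rationalTateAction_of`);
* `dualMap_toImage_comp_dualMap_of_corner` — the dual form `ᵗV_ℓ(ū₀) ∘ ᵗV_ℓ(j r) = ᵗV_ℓ(φ r) ∘ ᵗV_ℓ(ū₀)`;
* `baseChange_dualMap_toImage_eq_smul_of_corner` — EIGEN-TRANSPORT: a class `f₀ ∈ R′ ⊗ (V_ℓ Im u₀)^∨` that is `c`-eigen for
  `1 ⊗ ᵗV_ℓ(j r)` is carried by `1 ⊗ ᵗV_ℓ(ū₀)` to a `c`-eigen class for `1 ⊗ ᵗV_ℓ(φ r)` (the input of the cell's S2′ conjunct (4′)).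

Theorems only; no definition, no named fact, no instance, no `sorry`; any base field.  DICTIONARY LINE (cell `hodgecm-mathlib`,
crux `HLiu418` = stmt-HodgeConjecture-24832, d6 S2′ `BlockShape′`): `j` is the `(j : R₀ →+* (image u₀).endAlgebra)` binder and the
eigen-transport feeds (4′); count-neutral (HC_CM is proved only modulo the 7 printed citations until rung 0 closes).

## References
* [MumfordAV1970] D. Mumford, *Abelian Varieties* (1970), §19 Thm. 1 (p. 173), proof of Cor. 2 (p. 174), Thm. 3 (p. 176).
* [Liu2021] Y. Liu, *Fourier–Jacobi cycles and arithmetic relative trace formula*, Camb. J. Math. 9 (2021), App. D, proof of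
  Thm. D.6 (1) (p. 140; FJcycle.tex l. 5626).
* [Shimura1998] G. Shimura, *Abelian Varieties with Complex Multiplication and Modular Functions* (1998), §5.1 (p. 35: rational
  structures `ι : F → End_Q(A)`), §7.1 (pp. 46–47).
-/

set_option autoImplicit false

noncomputable section

open CategoryTheory
open scoped TensorProduct

namespace Literature.AlgebraicGeometry.Motives

namespace AbelianVariety

universe u

variable {K : Type u} [Field K] {X : AbelianVariety K}
variable {R₀ : Type*} [CommRing R₀] (φ : R₀ →ₙ+* X.endAlgebra) {u₀ : X ⟶ X} {d : ℕ}

/-- **A corner subring dominating `u₀` acts unitally on `Im u₀`, compatibly with `V_ℓ(X ↠ Im u₀)`.**  For a non-unital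
multiplicative `φ : R₀ → End⁰(X)` from a commutative ring, and an honest quasi-idempotent `u₀` (`u₀ ≫ u₀ = d • u₀`, `d ≠ 0`) with
`φ(r)·(1⊗u₀) = (1⊗u₀)·φ(r)` and `φ(1)·(1⊗u₀) = 1⊗u₀`: a ring homomorphism `j : R₀ →+* End⁰(Im u₀)` which is restriction on honest
elements and satisfies `V_ℓ(j r) ∘ V_ℓ(ū₀) = V_ℓ(ū₀) ∘ V_ℓ(φ r)` for every prime `ℓ`.
[cite: MumfordAV1970, §19 Thm. 1 (p. 173), proof of Cor. 2 (p. 174) and Thm. 3 (p. 176)] [cite: Liu2021, App. D, proof of Thm. D.6 (1) (p. 140)]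
[cite: Shimura1998, §5.1 (p. 35)] -/
theorem exists_ringHom_endAlgebra_image_of_corner (hd : d ≠ 0) (hu : u₀ ≫ u₀ = d • u₀)
    (hcomm : ∀ r : R₀, φ r * endAlgebra.of X u₀ = endAlgebra.of X u₀ * φ r)
    (hunit : φ 1 * endAlgebra.of X u₀ = endAlgebra.of X u₀) :
    ∃ j : R₀ →+* (image u₀).endAlgebra,
      (∀ (r : R₀) (F : X ⟶ X) (hF : endAlgebra.of X F = φ r) (hFu : F ≫ u₀ = u₀ ≫ F),
          j r = endAlgebra.of (image u₀) (imageRestrict u₀ F F hFu)) ∧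
      ∀ (ℓ : ℕ) [Fact ℓ.Prime] (r : R₀),
        rationalTateAction (image u₀) ℓ (j r) ∘ₗ rationalTateModuleMap ℓ (toImage u₀) =
          rationalTateModuleMap ℓ (toImage u₀) ∘ₗ rationalTateAction X ℓ (φ r) := by
  classical
  have hinj : Function.Injective (endAlgebra.of X) :=
    endAlgebra.of_injective_of_isIsogeny_zsmul_id (isIsogeny_zsmul_id_holds X)
  -- the commutative subalgebra `ℚ[φ(R₀), 1 ⊗ u₀]`
  set S : Set X.endAlgebra := insert (endAlgebra.of X u₀) (Set.range φ) with hSdef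
  have hS : ∀ x ∈ S, ∀ y ∈ S, x * y = y * x := by
    intro x hx y hy
    rcases hx with rfl | ⟨a, rfl⟩ <;> rcases hy with rfl | ⟨b, rfl⟩
    · rfl
    · exact (hcomm b).symm
    · exact hcomm a
    · rw [← map_mul, ← map_mul, mul_comm]
  have hSc := Algebra.isMulCommutative_adjoin ℚ hS
  let R : Subalgebra ℚ X.endAlgebra := Algebra.adjoin ℚ S
  have hRcomm : ∀ x ∈ R, ∀ y ∈ R, x * y = y * x := fun x hx y hy =>
    congrArg Subtype.val (hSc.is_comm.comm (⟨x, hx⟩ : R) ⟨y, hy⟩)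
  have hu₀R : endAlgebra.of X u₀ ∈ R := Algebra.subset_adjoin (Set.mem_insert _ _)
  have hφR : ∀ r, φ r ∈ R := fun r => Algebra.subset_adjoin (Set.mem_insert_of_mem _ ⟨r, rfl⟩)
  obtain ⟨ρ, hρF, -, hρ0⟩ := exists_ringHom_endAlgebra_image_of_comm_of_quasiIdempotent R hRcomm hu₀R hd hu
  -- `ρ(φ 1) = 1`: `(φ 1 - 1)(1 ⊗ u₀) = 0`
  have hone : ρ ⟨φ 1, hφR 1⟩ = 1 := by
    have h0 : ρ (⟨φ 1, hφR 1⟩ - 1) = 0 := hρ0 _ (by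
      change (φ 1 - 1) * endAlgebra.of X u₀ = 0
      rw [sub_mul, one_mul, hunit, sub_self])
    have hms : ρ (⟨φ 1, hφR 1⟩ - 1) = ρ ⟨φ 1, hφR 1⟩ - ρ 1 := map_sub ρ (⟨φ 1, hφR 1⟩ : R) 1
    rw [hms, ρ.map_one, sub_eq_zero] at h0
    exact h0
  -- the unital action `j`
  let j : R₀ →+* (image u₀).endAlgebra :=
    { toFun := fun r => ρ ⟨φ r, hφR r⟩
      map_one' := hone
      map_mul' := fun a b => by
        have h : (⟨φ (a * b), hφR (a * b)⟩ : R) = ⟨φ a, hφR a⟩ * ⟨φ b, hφR b⟩ := Subtype.ext (map_mul φ a b)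
        rw [h, ρ.map_mul]
      map_zero' := by
        have h : (⟨φ 0, hφR 0⟩ : R) = 0 := Subtype.ext (map_zero φ)
        rw [h, ρ.map_zero]
      map_add' := fun a b => by
        have h : (⟨φ (a + b), hφR (a + b)⟩ : R) = ⟨φ a, hφR a⟩ + ⟨φ b, hφR b⟩ := Subtype.ext (map_add φ a b)
        rw [h, ρ.map_add] }
  have hj : ∀ r, j r = ρ ⟨φ r, hφR r⟩ := fun r => rfl
  refine ⟨j, fun r F hF hFu => ?_, fun ℓ _ r => ?_⟩
  · -- honest elements act by restriction
    rw [hj]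
    have h : (⟨φ r, hφR r⟩ : R) = ⟨endAlgebra.of X F, hF ▸ hφR r⟩ := Subtype.ext hF.symm
    rw [h]
    exact hρF F _ hFu
  · -- `φ r = M⁻¹ (1 ⊗ F)`; compare `V_ℓ` of the honest `F` on `X` and of its restriction on `Im u₀`
    obtain ⟨M, F, hM, hr⟩ := endAlgebra.exists_eq_algebraMap_mul_of (φ r)
    have hMq : (M : ℚ) ≠ 0 := Nat.cast_ne_zero.2 hM
    have hF : endAlgebra.of X F = (M : X.endAlgebra) * φ r := by
      rw [hr, ← mul_assoc, ← map_natCast (algebraMap ℚ X.endAlgebra), ← map_mul, mul_inv_cancel₀ hMq, map_one,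
        one_mul]
    have hFu' : endAlgebra.of X F * endAlgebra.of X u₀ = endAlgebra.of X u₀ * endAlgebra.of X F := by
      rw [hF, mul_assoc, hcomm r, ← mul_assoc, ← mul_assoc, (Nat.cast_commute M _).eq]
    have hFu : F ≫ u₀ = u₀ ≫ F := by
      have h : @HMul.hMul (End X) (End X) (End X) instHMul F u₀ =
          @HMul.hMul (End X) (End X) (End X) instHMul u₀ F :=
        hinj (by rw [map_mul, map_mul, hFu'])
      exact h.symm
    have hMR : ((M : R) : X.endAlgebra) = M := map_natCast R.val M
    have hFR : endAlgebra.of X F ∈ R := by rw [hF]; exact R.mul_mem (hMR ▸ (M : R).2) (hφR r)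
    -- `M · j r = 1 ⊗ F|_{Im u₀}`
    have hρF' : (M : (image u₀).endAlgebra) * j r = endAlgebra.of (image u₀) (imageRestrict u₀ F F hFu) := by
      rw [hj, ← hρF F hFR hFu, ← map_natCast ρ M, ← map_mul]
      congr 1
      apply Subtype.ext
      change ((M : R) : X.endAlgebra) * φ r = endAlgebra.of X F
      rw [hMR, hF]
    -- apply `V_ℓ`
    have hT : (M : ℚ_[ℓ]) • rationalTateAction (image u₀) ℓ (j r) =
        rationalTateModuleMap ℓ (imageRestrict u₀ F F hFu) := by
      have h := congrArg (rationalTateAction (image u₀) ℓ) hρF'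
      rw [map_mul, map_natCast, rationalTateAction_of] at h
      rwa [Nat.cast_smul_eq_nsmul, nsmul_eq_mul]
    have hTX : rationalTateModuleMap ℓ F = (M : ℚ_[ℓ]) • rationalTateAction X ℓ (φ r) := by
      rw [← rationalTateAction_of, hF, map_mul, map_natCast, Nat.cast_smul_eq_nsmul, nsmul_eq_mul]
    have hcomp : rationalTateModuleMap ℓ (imageRestrict u₀ F F hFu) ∘ₗ rationalTateModuleMap ℓ (toImage u₀) =
        rationalTateModuleMap ℓ (toImage u₀) ∘ₗ rationalTateModuleMap ℓ F := by
      rw [← rationalTateModuleMap_comp, ← rationalTateModuleMap_comp, toImage_imageRestrict]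
    have hMℓ : (M : ℚ_[ℓ]) ≠ 0 := Nat.cast_ne_zero.2 hM
    apply smul_right_injective (X.rationalTateModule ℓ →ₗ[ℚ_[ℓ]] (image u₀).rationalTateModule ℓ) hMℓ
    change (M : ℚ_[ℓ]) • (_ ∘ₗ _) = (M : ℚ_[ℓ]) • (_ ∘ₗ _)
    rw [← LinearMap.smul_comp, hT, hcomp, hTX, LinearMap.comp_smul]

/-- **Dual form**: `ᵗV_ℓ(ū₀) ∘ ᵗV_ℓ(j r) = ᵗV_ℓ(φ r) ∘ ᵗV_ℓ(ū₀)` for any `j` intertwined as in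
`exists_ringHom_endAlgebra_image_of_corner`. [cite: MumfordAV1970, §19 Thm. 1 (p. 173) and Thm. 3 (p. 176)] -/
theorem dualMap_toImage_comp_dualMap_of_corner (ℓ : ℕ) [Fact ℓ.Prime] {j : R₀ →+* (image u₀).endAlgebra} {r : R₀}
    (hj : rationalTateAction (image u₀) ℓ (j r) ∘ₗ rationalTateModuleMap ℓ (toImage u₀) =
      rationalTateModuleMap ℓ (toImage u₀) ∘ₗ rationalTateAction X ℓ (φ r)) :
    (rationalTateModuleMap ℓ (toImage u₀)).dualMap ∘ₗ (rationalTateAction (image u₀) ℓ (j r)).dualMap =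
      (rationalTateAction X ℓ (φ r)).dualMap ∘ₗ (rationalTateModuleMap ℓ (toImage u₀)).dualMap := by
  rw [LinearMap.dualMap_comp_dualMap, LinearMap.dualMap_comp_dualMap, hj]

/-- **Eigen-transport along `X ↠ Im u₀`**: if `f₀ ∈ R′ ⊗ (V_ℓ Im u₀)^∨` is `c`-eigen for `1 ⊗ ᵗV_ℓ(j r)`, then its image
under `1 ⊗ ᵗV_ℓ(ū₀)` is `c`-eigen for `1 ⊗ ᵗV_ℓ(φ r)` (the input of the cell's S2′ conjunct (4′): eigenvectors of the block
field on `Im u₀` transport to eigen classes of the Hecke centre on `A_K`). [cite: MumfordAV1970, §19 Thm. 3 (p. 176)]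
[cite: Liu2021, App. D, proof of Thm. D.6 (1) (p. 140)] -/
theorem baseChange_dualMap_toImage_eq_smul_of_corner (ℓ : ℕ) [Fact ℓ.Prime] {j : R₀ →+* (image u₀).endAlgebra}
    {r : R₀} (hj : rationalTateAction (image u₀) ℓ (j r) ∘ₗ rationalTateModuleMap ℓ (toImage u₀) =
      rationalTateModuleMap ℓ (toImage u₀) ∘ₗ rationalTateAction X ℓ (φ r))
    (R' : Type*) [CommRing R'] [Algebra ℚ_[ℓ] R'] (c : R')
    (f₀ : R' ⊗[ℚ_[ℓ]] Module.Dual ℚ_[ℓ] ((image u₀).rationalTateModule ℓ))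
    (hf₀ : ((rationalTateAction (image u₀) ℓ (j r)).dualMap).baseChange R' f₀ = c • f₀) :
    ((rationalTateAction X ℓ (φ r)).dualMap).baseChange R'
        (((rationalTateModuleMap ℓ (toImage u₀)).dualMap).baseChange R' f₀) =
      c • ((rationalTateModuleMap ℓ (toImage u₀)).dualMap).baseChange R' f₀ := by
  rw [← LinearMap.comp_apply, ← LinearMap.baseChange_comp, ← dualMap_toImage_comp_dualMap_of_corner φ ℓ hj,
    LinearMap.baseChange_comp, LinearMap.comp_apply, hf₀, map_smul]

end AbelianVariety

end Literature.AlgebraicGeometry.Motives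

end
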